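import Literature.NumberTheory.EllipticCurves.ComplexMultiplicationDeuringReductionProofs
import Literature.NumberTheory.EllipticCurves.DeuringSplitOrdinaryModelsProofs
import HarnessLib

/-!
# Deuring's theorem (Lang, *Elliptic Functions*, Ch. 13 §4 Thm. 12), split case — discharged

Topic `NumberTheory/EllipticCurves` (trunk T-ELLARITH, notion `cm_endomorphisms_isogeny`).
Sibling of `ComplexMultiplicationDeuringReductionProofs`, which states the named fact
`Deuring1941_exists_pTorsion_reduction_of_split` (D1): *for `E/ℚ` given by a globally minimal `W`
with `j(W) ∈ maximalCMJInvariants` — CM by the maximal order of `K = ℚ(√d)`, `d = cmDiscr (j W)` —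
and an odd prime `p ∤ d Δ_W` at which `d` is a square (i.e. `p` splits in `K`), the reduction
`Ē = reductionModPrime W p` has a point of order `p` over `\overline{𝔽_p}` (is ordinary).* This
file proves it:

* `Deuring1941_exists_pTorsion_reduction_of_split_holds`.

The proof follows Lang's (PDF pp. 140–141: reduce a complex multiplication `λ` with
`p ∤ λ λ̄`… here `λ = √d`, and an `𝔽_p`-rational `ψ̄` with `ψ̄² = [d]`, `(d/p) = 1`, forces
`Ē[p] ≠ 0` by degrees and inseparability, `DeuringSplitOrdinaryProofs`), with the complex
multiplications made explicit: for the six odd `d = -7, -11, -19, -43, -67, -163` and for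
`d = -3, -4` the endomorphism `[√d]` (resp. `[√-3]`, `[i]`) is the twist of a kernel-certified
rational isogeny `E → E^{(d)}` (`CMIsogenyCertificates`, `DeuringSplitOrdinaryCertProofs`,
reduced modulo a place of `\overline{ℚ(√d)}` above `p` by lifting points,
`IsogenyFormulaReduction`/`IsogenyFormulaOfPlace`/`IsogenyFormulaOfPlaceCompSelf`), and for
`d = -8` it is `[√-2] =` (twist) `∘` (the `2`-isogeny with kernel `(0,0)`) on
`y² = x³ + 4x² + 2x` directly over `𝔽_p` (`DeuringSplitOrdinarySqrtTwoProofs`); the passage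
from these models to an arbitrary `W` with the same `j` is `DeuringSplitOrdinaryModelsProofs`
(`j` classifies curves over `\overline{𝔽_p}`; the special fibre `(d, p) = (-11, 3)` by hand).

## References

* [Lang1987] S. Lang, *Elliptic Functions*, 2nd ed., GTM 112, Ch. 13 §4 Thm. 12 and its proof
  (PDF pp. 140–141); Ch. 13 introduction (PDF p. 130).
* [Deuring1941] M. Deuring, *Die Typen der Multiplikatorenringe elliptischer Funktionenkörper*,
  Abh. Math. Sem. Univ. Hamburg 14 (1941), 197–272.
-/

open WeierstrassCurve

namespace Literature.NumberTheory.EllipticCurves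

/-- **Deuring's theorem, split case (Lang, *Elliptic Functions*, Ch. 13 §4 Thm. 12, first
assertion; Deuring 1941): the reduction of a maximal-order CM curve over `ℚ` at an odd prime of
good reduction which splits in the CM field has a point of order `p` over `\overline{𝔽_p}`** —
the named fact `Deuring1941_exists_pTorsion_reduction_of_split`, proved.
[cite: Lang1987, Ch. 13 §4 Thm. 12 (first assertion) and its proof (PDF pp. 140–141)]
[cite: Deuring1941] -/
theorem Deuring1941_exists_pTorsion_reduction_of_split_holds :
    Deuring1941_exists_pTorsion_reduction_of_split := by
  intro W _ _ hj p _ hp2 hΔ hd hsplit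
  simp only [maximalCMJInvariants, Finset.mem_insert, Finset.mem_singleton] at hj
  rcases hj with hj | hj | hj | hj | hj | hj | hj | hj | hj
  · have hc : cmDiscr W.j = -3 := by rw [hj]; norm_num [cmDiscr]
    rw [hc] at hd hsplit
    exact DeuringModels.exists_pTorsion_of_j_zero W hp2 hΔ hj hd hsplit
  · have hc : cmDiscr W.j = -4 := by rw [hj]; norm_num [cmDiscr]
    rw [hc] at hd hsplit
    exact DeuringModels.exists_pTorsion_of_j_1728 W hp2 hΔ hj hsplit
  · have hc : cmDiscr W.j = -7 := by rw [hj]; norm_num [cmDiscr]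
    rw [hc] at hd hsplit
    exact DeuringModels.exists_pTorsion_of_j_neg3375 W hp2 hΔ hj hd hsplit
  · have hc : cmDiscr W.j = -8 := by rw [hj]; norm_num [cmDiscr]
    rw [hc] at hd hsplit
    exact DeuringModels.exists_pTorsion_of_j_8000 W hp2 hΔ hj hsplit
  · have hc : cmDiscr W.j = -11 := by rw [hj]; norm_num [cmDiscr]
    rw [hc] at hd hsplit
    exact DeuringModels.exists_pTorsion_of_j_neg32768 W hp2 hΔ hj hd hsplit
  · have hc : cmDiscr W.j = -19 := by rw [hj]; norm_num [cmDiscr]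
    rw [hc] at hd hsplit
    exact DeuringModels.exists_pTorsion_of_j_neg884736 W hp2 hΔ hj hd hsplit
  · have hc : cmDiscr W.j = -43 := by rw [hj]; norm_num [cmDiscr]
    rw [hc] at hd hsplit
    exact DeuringModels.exists_pTorsion_of_j_neg884736000 W hp2 hΔ hj hd hsplit
  · have hc : cmDiscr W.j = -67 := by rw [hj]; norm_num [cmDiscr]
    rw [hc] at hd hsplit
    exact DeuringModels.exists_pTorsion_of_j_neg147197952000 W hp2 hΔ hj hd hsplit
  · have hc : cmDiscr W.j = -163 := by rw [hj]; norm_num [cmDiscr]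
    rw [hc] at hd hsplit
    exact DeuringModels.exists_pTorsion_of_j_neg262537412640768000 W hp2 hΔ hj hd hsplit

end Literature.NumberTheory.EllipticCurves
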